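import Summits.RiemannHypothesis.RiemannHypothesis.Theorems.Splittings.JensenX4HereditaryLaguerreRH

/-!
# T18 — the EXACT CLEAN FORM of the served split, in kernel (scratch, rh-splitx-theory-1 g3, §13.13)

`RH ⟺ XiPrimeOnLine ∧ C′`, where `C′` («Laguerre sign at real critical points off the zeros», the
level-0 Fourier-critical-point condition for `Re Ξ|ℝ`; typed as `LaguerreAtCriticalPoints` in
`Cruxes/LaguerreOnLine/Disproof.lean`) is spelled out as a formula below (no `def`s in this file).
BOTH conjuncts are consequences of RH (`xiPrimeOnLine_of_rh`, `laguerreAtCriticalPoints_of_rh`), and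
given `XiPrimeOnLine` the served crux `LaguerreOnLine` is exactly `C′ ∧ SZ_ℝ`.  This is the FUNCTION-LEVEL
analogue of the tree's hypothesis-free polynomial-level `JensenDerivativeLaguerre.rh_iff_rowsFromOne_and_rowZeroLaguerre`
(same shape `RH ⟺ A ∧ (level-0 Laguerre sign)`; the A-sides coincide by the landed
`JensenX4RowsFromOneXiPrime.rowsFromOne_iff_xiPrimeOnLine`, the B-sides are cousins: the sign law for every
row-0 Jensen polynomial `J^{d,0}` there, for `Ξ` itself here); the proofs are short corollaries of the landed
lane-(xvii) files (`JensenX4LaguerreHeredity`, `JensenX4HereditaryLaguerreRH`).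

HONEST LABEL: SPLITTING SEARCH over kernel-typed RH-EQUIVALENCES; a splitting A ∧ B ⟹ RH is CONDITIONAL
bookkeeping unless A and B are both proved; nothing here bears on the truth of RH.
-/

set_option linter.dupNamespace false

namespace Summit.RiemannHypothesis.RiemannHypothesis.Theorems.Splittings.JensenX4CleanSplit

open Literature.NumberTheory.LFunctions Literature.Analysis.Complex
open Summit.RiemannHypothesis.RiemannHypothesis.Theorems.Splittings.JensenX4LaguerreHeredity
open Summit.RiemannHypothesis.RiemannHypothesis.Theorems.Splittings.JensenX4HereditaryLaguerreRH

/-- RH ⟹ C′: the level `k = 0` instance of `laguerreHeredityOfRH`. -/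
theorem laguerreAtCriticalPoints_of_rh (hRH : _root_.RiemannHypothesis) :
    ∀ c : ℝ, deriv (fun u : ℝ => (riemannXiUpper (u : ℂ)).re) c = 0 →
      (riemannXiUpper (c : ℂ)).re ≠ 0 →
      (riemannXiUpper (c : ℂ)).re * iteratedDeriv 2 (fun u : ℝ => (riemannXiUpper (u : ℂ)).re) c < 0 := by
  intro c hc1 hc0
  have H := laguerreHeredityOfRH hRH 0 c
  rw [zero_add, iteratedDeriv_one, iteratedDeriv_zero] at H
  exact H hc1 hc0

/-- `XiPrimeOnLine ∧ C′ ⟹` the hereditary strict Laguerre sign law for `Re Ξ|ℝ` at every level: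
level `0` is `C′`, levels `≥ 1` come from `XiPrimeOnLine` through `laguerreHeredityOfXiPrime`. -/
theorem hasNoFourierCriticalPoint_reXi_of_xiPrimeOnLine_of_critical
    (hA : Theses.LaguerreSpeiserSplit.XiPrimeOnLine)
    (hC : ∀ c : ℝ, deriv (fun u : ℝ => (riemannXiUpper (u : ℂ)).re) c = 0 →
      (riemannXiUpper (c : ℂ)).re ≠ 0 →
      (riemannXiUpper (c : ℂ)).re * iteratedDeriv 2 (fun u : ℝ => (riemannXiUpper (u : ℂ)).re) c < 0) :
    HasNoFourierCriticalPoint (fun t : ℝ => (riemannXiUpper (t : ℂ)).re) := by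
  have hΞ : Differentiable ℂ riemannXiUpper := by
    have h : riemannXiUpper = fun w ↦ xiSq (-(w ^ 2)) :=
      funext Theorems.Splittings.JensenX4RowsFromOneXiPrime.riemannXiUpper_eq_xiSq
    rw [h]
    exact differentiable_xiSq.comp ((differentiable_id.pow 2).neg)
  have hderiv : deriv (fun t : ℝ => (riemannXiUpper (t : ℂ)).re)
      = fun t : ℝ => (deriv riemannXiUpper (t : ℂ)).re := by
    funext t
    exact (KiKim.hasDerivAt_re_ofReal (hΞ.differentiableAt)).deriv
  have h31 := laguerreHeredityOfXiPrime hA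
  intro l c hc1 hc0
  cases l with
  | zero =>
    rw [zero_add, iteratedDeriv_one] at hc1
    rw [iteratedDeriv_zero] at hc0 ⊢
    rw [zero_add]
    exact hC c hc1 hc0
  | succ l =>
    have e0 : iteratedDeriv (l + 1) (fun t : ℝ => (riemannXiUpper (t : ℂ)).re) c
        = iteratedDeriv l (fun t : ℝ => (deriv riemannXiUpper (t : ℂ)).re) c := by
      rw [iteratedDeriv_succ', hderiv]
    have e1 : iteratedDeriv (l + 1 + 1) (fun t : ℝ => (riemannXiUpper (t : ℂ)).re) c
        = iteratedDeriv (l + 1) (fun t : ℝ => (deriv riemannXiUpper (t : ℂ)).re) c := by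
      rw [iteratedDeriv_succ', hderiv]
    have e2 : iteratedDeriv (l + 1 + 2) (fun t : ℝ => (riemannXiUpper (t : ℂ)).re) c
        = iteratedDeriv (l + 2) (fun t : ℝ => (deriv riemannXiUpper (t : ℂ)).re) c := by
      rw [show l + 1 + 2 = (l + 2) + 1 by ring, iteratedDeriv_succ', hderiv]
    rw [e1] at hc1
    rw [e0] at hc0 ⊢
    rw [e2]
    exact h31 l c hc1 hc0

/-- **The exact clean form of the served split (§13.13):** `RH ⟺ XiPrimeOnLine ∧ C′`. -/
theorem rh_iff_xiPrimeOnLine_and_laguerreAtCriticalPoints :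
    _root_.RiemannHypothesis ↔
    (Theses.LaguerreSpeiserSplit.XiPrimeOnLine ∧
      ∀ c : ℝ, deriv (fun u : ℝ => (riemannXiUpper (u : ℂ)).re) c = 0 →
        (riemannXiUpper (c : ℂ)).re ≠ 0 →
        (riemannXiUpper (c : ℂ)).re * iteratedDeriv 2 (fun u : ℝ => (riemannXiUpper (u : ℂ)).re) c < 0) :=
  ⟨fun h ↦ ⟨xiPrimeOnLine_of_rh h, laguerreAtCriticalPoints_of_rh h⟩,
    fun h ↦ rh_of_hasNoFourierCriticalPoint_reXi
      (hasNoFourierCriticalPoint_reXi_of_xiPrimeOnLine_of_critical h.1 h.2)⟩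

/-- Given `XiPrimeOnLine`, the served crux `LaguerreOnLine` (stmt-18897) is EXACTLY `C′ ∧ SZ_ℝ`
(`SZ_ℝ` = every real zero of `Ξ` is simple): the over-typing of §13.12 made explicit. -/
theorem laguerreOnLine_iff_critical_and_simple (hA : Theses.LaguerreSpeiserSplit.XiPrimeOnLine) :
    Theses.LaguerreSpeiserSplit.LaguerreOnLine ↔
    ((∀ c : ℝ, deriv (fun u : ℝ => (riemannXiUpper (u : ℂ)).re) c = 0 →
        (riemannXiUpper (c : ℂ)).re ≠ 0 →
        (riemannXiUpper (c : ℂ)).re * iteratedDeriv 2 (fun u : ℝ => (riemannXiUpper (u : ℂ)).re) c < 0) ∧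
      ∀ t : ℝ, riemannXiUpper t = 0 → deriv riemannXiUpper t ≠ 0) := by
  constructor
  · intro hB
    refine ⟨fun c hc1 _hc0 ↦ ?_, (xiPrimeOnLine_and_laguerreOnLine_iff.mp ⟨hA, hB⟩).2⟩
    have h2 := hB c
    rw [hc1] at h2
    nlinarith [h2]
  · intro h
    exact laguerreOnLine_of_rh_of_simple
      (rh_iff_xiPrimeOnLine_and_laguerreAtCriticalPoints.mpr ⟨hA, h.1⟩) h.2

end Summit.RiemannHypothesis.RiemannHypothesis.Theorems.Splittings.JensenX4CleanSplit
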